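import Literature.NumberTheory.LFunctions.Zhang2022.Section8Lemma84PhiBounds
import Literature.NumberTheory.LFunctions.Zhang2022.GaussKernelContourScales
import HarnessLib

/-!
# Zhang (2022) §12, Lemmas 12.2–12.3: the big Landau contour for the SHIFTED quotient
# `Φ(s) = 𝔲(u)L(u+β_{j+1},χ)L(u+β_{j+2},χ)/L(u,χ)`, `u = 1 − s₀ + s`, against the Gaussian Perron kernel
# `Y^s ω₁(s)/s` — the shared layer «ShiftedContour» of the u025/u030 cores (theorems only)

Topic `Literature/NumberTheory/LFunctions/Zhang2022` (Landau–Siegel audit tree; verdict-neutral).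
Y. Zhang, *Discrete mean estimates and the Landau–Siegel zero*, arXiv:2211.02515v1 (2022)
[Zhang2022LandauSiegel] — **an unrefereed manuscript under adjudication; nothing here asserts or
denies its Theorems 1–2.** DAG nodes served: `Z22:§12.u025` (proof of Lemma 12.2, p. 69, tex L3534)
and `Z22:§12.u030` (proof of Lemma 12.3, p. 70, tex L3564) — "In a way similar to the proof of Lemma 8.4
… we find that [the Perron integral on `(1)`] is equal to `L′(1,χ)Π(d,r)·(2πi)⁻¹∫_{|s|=5α}(…) + O(𝓛⁻¹⁵)`"
(typed `Typed.Sec12B.U025 / U030`, OPEN cores of the ZHANG-L leaves h1212 / hTop25Ex). Lane ruling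
S-8 (zl-lib-1, 2026-08-27): the two cores share ONE big-contour layer, generic in the length `Y`
(`= P″₂/dr`, `P″₁/dr`) and in the shift `s₀` (`= β₆ − w`, `|w| = α`): this file.

WHAT IS PROVED (everything; no new definitions, no named facts). For an ARBITRARY continuation `U`
(playing Lemma 8.3's `𝔲_j(d,r;·)`; its holomorphy on `σ > 9/10` and a sup bound `M_U` left of `σ = 1`
are HYPOTHESES, as in the tree's `Lemma84.lemma84_core`), purely imaginary shifts `β_a, β_b` of modulus
`≤ 1/2`, a complex shift `s₀` with `‖s₀‖ ≤ η/10` (NOT assumed purely imaginary — this is the point of the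
file: `Re(β₆ − w) ≠ 0`), an `L`-bound `B_L` and the zero-free package "`‖L(s,χ)⁻¹‖ ≤ M_inv(1+|s−ρ|⁻¹)`,
`σ ≥ 1 − 2η`, `|t| ≤ H + 1`, `s ≠ ρ`" around the exceptional zero `ρ` (`L(ρ,χ) = 0 ≠ L′(ρ,χ)`,
`1 − η/4 ≤ ρ < 1`; all from the tree's `Lemma84.exceptional_package` + `Lemma84.norm_LFunction_le_near_one`),
and `Φ(s) = U(1−s₀+s)L(1−s₀+s+β_a)L(1−s₀+s+β_b)/L(1−s₀+s)`:

* `ShiftedContour.differentiableAt_Phi` — `Φ` is holomorphic at every `s` of the strip `Re s > −2η + η/5`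
  where `L(1−s₀+s) ≠ 0`; `ShiftedContour.LFunction_ne_zero_of_box` — inside the box `Re s ≥ −3η/2`,
  `|Im s| ≤ H + 1/2` the only zero of `L(1−s₀+s)` is `s_ρ := ρ − 1 + s₀`;
* the three sup bounds on Landau's contour (right line `Re s = 1`, left line `Re s = −η`, horizontal
  sides `Im s = ±H`): `norm_Phi_right_le'`, `norm_Phi_left_le'`, `norm_Phi_horiz_le'`
  (`27M_U`, `M_UB_L²M_inv(1+4/η)`, `3M_UB_L²M_inv`);
* the factorisation `L(1−s₀+z) = (z − s_ρ)·ψ(z)` (`ψ = dslope`, entire, `ψ(s_ρ) = L′(ρ,χ) ≠ 0`) and the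
  two SIMPLE-POLE limits of `G = Φ·K_Y`, `K_Y(s) = Y^sω₁(s)/s`: at `s = 0` the value `Φ(0)`, at `s = s_ρ`
  the value `U(ρ)L(ρ+β_a)L(ρ+β_b)/L′(ρ)·K_Y(s_ρ)` (`tendsto_mul_G_zero`, `tendsto_mul_G_pole`);
* **`norm_vline_sub_residues_le`** — Landau's broken line for `G` via the tree's Gaussian-kernel engine
  `GaussKernelContour.norm_lineIntegral_sub_sum_limUnder_le` (rectangle `[−η, 1] × [−H, H]`, poles
  `{0, s_ρ}`): `‖(1/2π)∫_ℝ G(1+it)dt − (Φ(0) + Res_{s_ρ})‖ ≤ (1/2π)(E_tails + E_left + 2E_horiz)` with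
  the engine's explicit pieces at `M₀ = 27M_U`, `M₁ = M_UB_L²M_inv(1+4/η)`, `M₂ = 3M_UB_L²M_inv`
  (the `exp{−c𝓛^{1/10}}` arithmetic is then ONE call of `GaussKernelContour.remainder_le_eps1` by the
  consumer, with `η = c₁/𝓛`, `H ≥ 𝓛²⁰`, `T ≤ Y ≤ P`).

How the two cores use it: u025's `lineInt024` is the DIFFERENCE of two such line integrals
(`Y = P″₂/dr`, `P″₁/dr`; the `Φ(0)` terms cancel), u030's is one (`Y = P″₂/dr`); the small circle
`C(β₆ − w, 3α)` and the model comparison are zl-w12-p8's `Section12ShiftedSmallCircle`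
(`Lemma84.norm_circ_true_sub_main_kernel1/2`); the residue route compares `Φ(0) + Res_{s_ρ}` with the
model directly. WHAT THIS IS NOT: a proof of u025/u030, nor of any error term's derivability
(relative vs absolute, row G-d55-3). «ZHANG-L proves typed steps of arXiv:2211.02515v1 in Lean; the §18
margin is refuted as printed (G-C1); no claim about Landau–Siegel zeros or Theorem 2 follows.»

## References

* Y. Zhang, arXiv:2211.02515v1 (2022), §12 proofs of Lemmas 12.2–12.3, pp. 69–70 (tex L3528–L3586);
  §8 proof of Lemma 8.4, p. 47; §5 Lemmas 5.5, 5.8; §4 (4.1) (`ω₁`).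
  [cite: Zhang2022LandauSiegel, §12 Lemmas 12.2–12.3, pp. 69–70]
* H. L. Montgomery, R. C. Vaughan, *Multiplicative Number Theory I*, CUP 2007, §6.2 (Landau's contour),
  Thm 11.4. [cite: MontgomeryVaughan2007, §6.2]
-/

noncomputable section

open Complex Real Set Filter Topology MeasureTheory

namespace Literature.NumberTheory.LFunctions.Zhang2022.Lemma84

namespace ShiftedContour

open GaussWeight GaussKernelContour

variable {D : ℕ} [NeZero D] (χ : DirichletCharacter ℂ D)
variable (U Φ : ℂ → ℂ) (s₀ βa βb : ℂ) {ρ η H Y MU BL Minv : ℝ}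

/-! ### The shifted argument `u = 1 − s₀ + s` -/

/-- Real and imaginary part of `u = 1 − s₀ + s`. [cite: Zhang2022LandauSiegel, §12 proof of Lemma 12.2, p. 69] -/
private theorem u_re_im (s : ℂ) : (1 - s₀ + s).re = 1 - s₀.re + s.re ∧ (1 - s₀ + s).im = s.im - s₀.im := by
  constructor
  · simp
  · simp; ring

/-- `|Re s₀|, |Im s₀| ≤ ‖s₀‖`. [folklore] -/
private theorem abs_re_im_le (h : ‖s₀‖ ≤ η / 10) : |s₀.re| ≤ η / 10 ∧ |s₀.im| ≤ η / 10 :=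
  ⟨(Complex.abs_re_le_norm _).trans h, (Complex.abs_im_le_norm _).trans h⟩

/-- Size of `u + β = 1 − s₀ + s + β` on the contour box: if `|Re s| ≤ 1`, `|Im s| ≤ H`, `‖s₀‖ ≤ η/10 ≤ 1`,
`‖β‖ ≤ 1`, then `‖1 − s₀ + s + β‖ ≤ H + 4` and `Re(1 − s₀ + s + β) = 1 − Re s₀ + Re s` (`Re β = 0`).
[cite: Zhang2022LandauSiegel, §12 proof of Lemma 12.2, p. 69] -/
private theorem norm_u_add_le (hs₀ : ‖s₀‖ ≤ η / 10) (hη1 : η ≤ 1) {β : ℂ} (hβ : β.re = 0) (hβ1 : ‖β‖ ≤ 1)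
    {s : ℂ} (hre : |s.re| ≤ 1) (him : |s.im| ≤ H) :
    ‖1 - s₀ + s + β‖ ≤ H + 4 ∧ (1 - s₀ + s + β).re = 1 - s₀.re + s.re := by
  constructor
  · have hs : ‖s‖ ≤ 1 + H := (Complex.norm_le_abs_re_add_abs_im s).trans (by linarith)
    have hs₀' : ‖s₀‖ ≤ 1 := by linarith
    calc ‖1 - s₀ + s + β‖ ≤ ‖1 - s₀ + s‖ + ‖β‖ := norm_add_le _ _
      _ ≤ (‖(1 : ℂ) - s₀‖ + ‖s‖) + ‖β‖ := by gcongr; exact norm_add_le _ _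
      _ ≤ ((‖(1 : ℂ)‖ + ‖s₀‖) + ‖s‖) + ‖β‖ := by gcongr; exact norm_sub_le _ _
      _ ≤ ((1 + 1) + (1 + H)) + 1 := by rw [norm_one]; gcongr
      _ = H + 4 := by ring
  · simp [hβ]

/-! ### `Φ` on the right line `Re s = 1` -/

/-- **`Φ` to the right**: if `‖U(w)‖ ≤ M_U` for `Re w ≥ 3/2` and `‖s₀‖ ≤ η/10 ≤ 1/10`, then for
`Re s ≥ 1`: `L(1−s₀+s) ≠ 0` and `‖Φ(s)‖ ≤ 27·M_U` (`|L|, |L|⁻¹ ≤ 3` for `Re ≥ 3/2`).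
[cite: Zhang2022LandauSiegel, §12 proof of Lemma 12.2, p. 69] [cite: MontgomeryVaughan2007, Lemma 11.1] -/
theorem norm_Phi_right_le' (hs₀ : ‖s₀‖ ≤ η / 10) (hη1 : η ≤ 1) (hβa : βa.re = 0) (hβb : βb.re = 0)
    (hΦ : ∀ s, Φ s = U (1 - s₀ + s) * χ.LFunction (1 - s₀ + s + βa) *
      χ.LFunction (1 - s₀ + s + βb) / χ.LFunction (1 - s₀ + s))
    (hMU : 0 ≤ MU) (hU : ∀ w : ℂ, 3 / 2 ≤ w.re → ‖U w‖ ≤ MU) {s : ℂ} (hs : 1 ≤ s.re) :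
    χ.LFunction (1 - s₀ + s) ≠ 0 ∧ ‖Φ s‖ ≤ 27 * MU := by
  obtain ⟨hwre, -⟩ := u_re_im s₀ s
  obtain ⟨hre, -⟩ := abs_re_im_le s₀ hs₀
  have hs₀re : s₀.re ≤ 1 / 10 := by have := (abs_le.mp hre).2; linarith
  have hw : 1 + 1 / 2 ≤ (1 - s₀ + s).re := by rw [hwre]; linarith
  have hwa : 1 + 1 / 2 ≤ (1 - s₀ + s + βa).re := by
    simp only [add_re, hβa, add_zero] at hw ⊢; exact hw
  have hwb : 1 + 1 / 2 ≤ (1 - s₀ + s + βb).re := by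
    simp only [add_re, hβb, add_zero] at hw ⊢; exact hw
  have h12 : (0 : ℝ) < 1 / 2 := by norm_num
  have ha := norm_LFunction_le_right' χ h12 hwa
  have hb := norm_LFunction_le_right' χ h12 hwb
  obtain ⟨hne, hinv⟩ := inv_LFunction_le_right χ h12 hw
  refine ⟨hne, ?_⟩
  rw [hΦ s]
  have h3 : (1 + 1 / 2 : ℝ) / (1 / 2) = 3 := by norm_num
  rw [h3] at ha hb hinv
  calc _ ≤ MU * 3 * 3 * 3 := norm_quot_le hMU (by norm_num) (hU _ (by linarith)) ha hb hinv
    _ = 27 * MU := by ring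

/-! ### The zero-free box and holomorphy of `Φ` -/

/-- **`L(1−s₀+s,χ) ≠ 0` in the box off the exceptional point**: if `L(w,χ) ≠ 0` for `Re w ≥ 1 − 2η`,
`|Im w| ≤ H + 1`, `w ≠ ρ`, and `‖s₀‖ ≤ η/10`, then for `Re s ≥ −3η/2`, `|Im s| ≤ H + 1/2`,
`s ≠ s_ρ := ρ − 1 + s₀`: `L(1 − s₀ + s, χ) ≠ 0`. [cite: Zhang2022LandauSiegel, §5 Lemma 5.5]
[cite: MontgomeryVaughan2007, Thm 11.4] -/
theorem LFunction_ne_zero_of_box (hs₀ : ‖s₀‖ ≤ η / 10) (hη1 : η ≤ 1)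
    (hzf : ∀ w : ℂ, 1 - 2 * η ≤ w.re → |w.im| ≤ H + 1 → w ≠ (ρ : ℂ) → χ.LFunction w ≠ 0)
    {s : ℂ} (hre : -(3 * η / 2) ≤ s.re) (him : |s.im| ≤ H + 1 / 2)
    (hne : s ≠ ((ρ - 1 : ℝ) : ℂ) + s₀) : χ.LFunction (1 - s₀ + s) ≠ 0 := by
  obtain ⟨hwre, hwim⟩ := u_re_im s₀ s
  obtain ⟨hre₀, him₀⟩ := abs_re_im_le s₀ hs₀
  have hη0 : 0 ≤ η := by linarith [norm_nonneg s₀]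
  refine hzf _ ?_ ?_ ?_
  · rw [hwre]; have := (abs_le.mp hre₀).2; linarith
  · rw [hwim]
    have h1 := abs_sub s.im s₀.im
    linarith
  · intro h
    apply hne
    have : s = (ρ : ℂ) - 1 + s₀ := by rw [← h]; ring
    rw [this]; push_cast; ring

/-- **Holomorphy of `Φ`** at every `s` with `Re s > −1/10 + 1/10·0` … precisely `Re(1−s₀+s) > 9/10` and
`L(1−s₀+s,χ) ≠ 0` (`χ ≠ χ₀`, `U` holomorphic on `σ > 9/10`, `L` entire).
[cite: Zhang2022LandauSiegel, §8 Lemma 8.3] -/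
theorem differentiableAt_Phi (hχ1 : χ ≠ 1) (hUd : DifferentiableOn ℂ U {s : ℂ | 9 / 10 < s.re})
    (hΦ : ∀ s, Φ s = U (1 - s₀ + s) * χ.LFunction (1 - s₀ + s + βa) *
      χ.LFunction (1 - s₀ + s + βb) / χ.LFunction (1 - s₀ + s))
    {s : ℂ} (hs : 9 / 10 < (1 - s₀ + s).re) (hL : χ.LFunction (1 - s₀ + s) ≠ 0) :
    DifferentiableAt ℂ Φ s := by
  have hΦ' : Φ = fun s => U (1 - s₀ + s) * χ.LFunction (1 - s₀ + s + βa) *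
      χ.LFunction (1 - s₀ + s + βb) / χ.LFunction (1 - s₀ + s) := funext hΦ
  rw [hΦ']
  have hLd := DirichletCharacter.differentiable_LFunction hχ1
  have hw : DifferentiableAt ℂ (fun s : ℂ => 1 - s₀ + s) s := by fun_prop
  have hU : DifferentiableAt ℂ (fun s : ℂ => U (1 - s₀ + s)) s := by
    have hopen : IsOpen {s : ℂ | 9 / 10 < s.re} := isOpen_lt continuous_const Complex.continuous_re
    exact (hUd.differentiableAt (hopen.mem_nhds hs)).comp s hw
  have h1 : DifferentiableAt ℂ (fun s : ℂ => χ.LFunction (1 - s₀ + s + βa)) s :=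
    (hLd _).comp s (by fun_prop)
  have h2 : DifferentiableAt ℂ (fun s : ℂ => χ.LFunction (1 - s₀ + s + βb)) s :=
    (hLd _).comp s (by fun_prop)
  have h3 : DifferentiableAt ℂ (fun s : ℂ => χ.LFunction (1 - s₀ + s)) s := (hLd _).comp s hw
  exact ((hU.mul h1).mul h2).div h3 hL

/-! ### `Φ` on the left line and on the horizontal sides -/

/-- **`Φ` on the left line `Re s = −η`** (`|t| ≤ H`): with `‖U(w)‖ ≤ M_U` on `Re w ≥ 1 − 2η`,
`‖L(w,χ)‖ ≤ B_L` for `Re w ≥ 1 − 2η`, `‖w‖ ≤ H + 4`, the zero-free package with constant `M_inv` on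
`Re w ≥ 1 − 2η`, `|Im w| ≤ H + 1`, and `1 − η/4 ≤ ρ`, `‖s₀‖ ≤ η/10`, `η ≤ 1`:
`‖Φ(−η + it)‖ ≤ M_U B_L² M_inv (1 + 4/η)` (`|u − ρ| ≥ Re(ρ − u) ≥ η/2`, so `1 + |u−ρ|⁻¹ ≤ 1 + 2/η ≤ 1 + 4/η`).
[cite: Zhang2022LandauSiegel, §12 proof of Lemma 12.2, p. 69] [cite: MontgomeryVaughan2007, Thm 11.4] -/
theorem norm_Phi_left_le' (hη : 0 < η) (hη1 : η ≤ 1) (hs₀ : ‖s₀‖ ≤ η / 10)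
    (hβa : βa.re = 0) (hβa1 : ‖βa‖ ≤ 1) (hβb : βb.re = 0) (hβb1 : ‖βb‖ ≤ 1)
    (hΦ : ∀ s, Φ s = U (1 - s₀ + s) * χ.LFunction (1 - s₀ + s + βa) *
      χ.LFunction (1 - s₀ + s + βb) / χ.LFunction (1 - s₀ + s))
    (hMU : 0 ≤ MU) (hU : ∀ w : ℂ, 1 - 2 * η ≤ w.re → ‖U w‖ ≤ MU) (hBL : 0 ≤ BL)
    (hL : ∀ w : ℂ, 1 - 2 * η ≤ w.re → ‖w‖ ≤ H + 4 → ‖χ.LFunction w‖ ≤ BL) (hMinv : 0 ≤ Minv)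
    (hpack : ∀ w : ℂ, 1 - 2 * η ≤ w.re → |w.im| ≤ H + 1 → w ≠ (ρ : ℂ) →
      χ.LFunction w ≠ 0 ∧ ‖(χ.LFunction w)⁻¹‖ ≤ Minv * (1 + ‖w - ρ‖⁻¹))
    (hρ : 1 - η / 4 ≤ ρ) {t : ℝ} (ht : |t| ≤ H) :
    ‖Φ (((-η : ℝ) : ℂ) + t * I)‖ ≤ MU * BL * BL * (Minv * (1 + 4 / η)) := by
  set s : ℂ := ((-η : ℝ) : ℂ) + t * I with hs
  have hsre : s.re = -η := by simp [hs]
  have hsim : s.im = t := by simp [hs]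
  obtain ⟨hwre, hwim⟩ := u_re_im s₀ s
  obtain ⟨hre₀, him₀⟩ := abs_re_im_le s₀ hs₀
  have hre₀' := abs_le.mp hre₀
  have hre1 : |s.re| ≤ 1 := by rw [hsre, abs_neg, abs_of_pos hη]; exact hη1
  have him : |s.im| ≤ H := by rw [hsim]; exact ht
  obtain ⟨hna, hrea⟩ := norm_u_add_le s₀ hs₀ hη1 hβa hβa1 hre1 him
  obtain ⟨hnb, hreb⟩ := norm_u_add_le s₀ hs₀ hη1 hβb hβb1 hre1 him
  have ha := hL _ (by rw [hrea, hsre]; linarith) hna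
  have hb := hL _ (by rw [hreb, hsre]; linarith) hnb
  have hUw := hU _ (by rw [hwre, hsre]; linarith)
  -- the zero-free package at `u`
  have hwρ : η / 2 ≤ ‖(1 - s₀ + s) - ρ‖ := by
    have h1 : |((1 - s₀ + s) - ρ).re| ≤ ‖(1 - s₀ + s) - ρ‖ := Complex.abs_re_le_norm _
    have h2 : ((1 - s₀ + s) - ρ).re = 1 - s₀.re - η - ρ := by
      rw [sub_re, hwre, hsre, Complex.ofReal_re]; ring
    rw [h2] at h1
    have h3 : η / 2 ≤ |1 - s₀.re - η - ρ| := by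
      rw [abs_of_nonpos (by linarith)]; linarith
    exact h3.trans h1
  have hwne : (1 - s₀ + s) ≠ (ρ : ℂ) := by
    intro h
    rw [h, sub_self, norm_zero] at hwρ
    linarith
  have hwim' : |(1 - s₀ + s).im| ≤ H + 1 := by
    rw [hwim, hsim]
    have h1 := abs_sub t s₀.im
    linarith
  obtain ⟨-, hinv⟩ := hpack _ (by rw [hwre, hsre]; linarith) hwim' hwne
  have hinv' : ‖(χ.LFunction (1 - s₀ + s))⁻¹‖ ≤ Minv * (1 + 4 / η) := by
    refine hinv.trans (mul_le_mul_of_nonneg_left ?_ hMinv)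
    have : ‖(1 - s₀ + s) - ρ‖⁻¹ ≤ 2 / η := by
      rw [inv_le_comm₀ (lt_of_lt_of_le (by positivity) hwρ) (by positivity), inv_div]
      exact hwρ
    have h4 : 2 / η ≤ 4 / η := by gcongr; norm_num
    linarith
  rw [hΦ s]
  exact norm_quot_le hMU hBL hUw ha hb hinv'

/-- **`Φ` on the horizontal sides `Im s = ±H`** (`−η ≤ Re s ≤ 1`, `H ≥ 2`): with the same data,
`‖Φ(x ± iH)‖ ≤ 3 M_U B_L² M_inv` (`|u − ρ| ≥ |Im u| ≥ H − η/10 ≥ 1`).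
[cite: Zhang2022LandauSiegel, §12 proof of Lemma 12.2, p. 69] [cite: MontgomeryVaughan2007, Thm 11.4] -/
theorem norm_Phi_horiz_le' (hη : 0 < η) (hη1 : η ≤ 1) (hs₀ : ‖s₀‖ ≤ η / 10) (hH : 2 ≤ H)
    (hβa : βa.re = 0) (hβa1 : ‖βa‖ ≤ 1) (hβb : βb.re = 0) (hβb1 : ‖βb‖ ≤ 1)
    (hΦ : ∀ s, Φ s = U (1 - s₀ + s) * χ.LFunction (1 - s₀ + s + βa) *
      χ.LFunction (1 - s₀ + s + βb) / χ.LFunction (1 - s₀ + s))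
    (hMU : 0 ≤ MU) (hU : ∀ w : ℂ, 1 - 2 * η ≤ w.re → ‖U w‖ ≤ MU) (hBL : 0 ≤ BL)
    (hL : ∀ w : ℂ, 1 - 2 * η ≤ w.re → ‖w‖ ≤ H + 4 → ‖χ.LFunction w‖ ≤ BL) (hMinv : 0 ≤ Minv)
    (hpack : ∀ w : ℂ, 1 - 2 * η ≤ w.re → |w.im| ≤ H + 1 → w ≠ (ρ : ℂ) →
      χ.LFunction w ≠ 0 ∧ ‖(χ.LFunction w)⁻¹‖ ≤ Minv * (1 + ‖w - ρ‖⁻¹))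
    {x y : ℝ} (hx1 : -η ≤ x) (hx2 : x ≤ 1) (hy : |y| = H) :
    ‖Φ ((x : ℂ) + y * I)‖ ≤ MU * BL * BL * (Minv * 3) := by
  set s : ℂ := (x : ℂ) + y * I with hs
  have hsre : s.re = x := by simp [hs]
  have hsim : s.im = y := by simp [hs]
  obtain ⟨hwre, hwim⟩ := u_re_im s₀ s
  obtain ⟨hre₀, him₀⟩ := abs_re_im_le s₀ hs₀
  have hre₀' := abs_le.mp hre₀
  have him₀' := abs_le.mp him₀
  have hre1 : |s.re| ≤ 1 := by rw [hsre, abs_le]; constructor <;> linarith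
  have him : |s.im| ≤ H := by rw [hsim, hy]
  obtain ⟨hna, hrea⟩ := norm_u_add_le s₀ hs₀ hη1 hβa hβa1 hre1 him
  obtain ⟨hnb, hreb⟩ := norm_u_add_le s₀ hs₀ hη1 hβb hβb1 hre1 him
  have ha := hL _ (by rw [hrea, hsre]; linarith) hna
  have hb := hL _ (by rw [hreb, hsre]; linarith) hnb
  have hUw := hU _ (by rw [hwre, hsre]; linarith)
  -- the zero-free package at `u`
  have hwρ : 1 ≤ ‖(1 - s₀ + s) - ρ‖ := by
    have h1 : |((1 - s₀ + s) - ρ).im| ≤ ‖(1 - s₀ + s) - ρ‖ := Complex.abs_im_le_norm _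
    have h2 : ((1 - s₀ + s) - ρ).im = y - s₀.im := by
      rw [sub_im, hwim, hsim, Complex.ofReal_im]; ring
    rw [h2] at h1
    have h3 := abs_sub_abs_le_abs_sub y s₀.im
    rw [hy] at h3
    linarith
  have hwne : (1 - s₀ + s) ≠ (ρ : ℂ) := by
    intro h
    rw [h, sub_self, norm_zero] at hwρ
    linarith
  have hwim' : |(1 - s₀ + s).im| ≤ H + 1 := by
    rw [hwim, hsim]
    have h1 := abs_sub y s₀.im
    rw [hy] at h1
    linarith
  obtain ⟨-, hinv⟩ := hpack _ (by rw [hwre, hsre]; linarith) hwim' hwne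
  have hinv' : ‖(χ.LFunction (1 - s₀ + s))⁻¹‖ ≤ Minv * 3 := by
    refine hinv.trans (mul_le_mul_of_nonneg_left ?_ hMinv)
    have : ‖(1 - s₀ + s) - ρ‖⁻¹ ≤ 1 := inv_le_one_of_one_le₀ hwρ
    linarith
  rw [hΦ s]
  exact norm_quot_le hMU hBL hUw ha hb hinv'


/-! ### The simple zero of `L(1 − s₀ + z, χ)` at `z = s_ρ` -/

/-- **Factoring the exceptional zero**: with `s_ρ := ρ − 1 + s₀` (so that `1 − s₀ + s_ρ = ρ`) and
`L(ρ,χ) = 0`, `L(1 − s₀ + z, χ) = (z − s_ρ)·ψ(z)` for an entire `ψ` with `ψ(s_ρ) = L′(ρ,χ)` (Mathlib's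
`dslope`). [cite: Zhang2022LandauSiegel, §5 Lemma 5.5] -/
theorem exists_factor_LFunction_shift (hχ1 : χ ≠ 1) (hLρ : χ.LFunction ρ = 0) :
    ∃ ψ : ℂ → ℂ, Differentiable ℂ ψ ∧ ψ (((ρ - 1 : ℝ) : ℂ) + s₀) = deriv χ.LFunction ρ ∧
      ∀ z, χ.LFunction (1 - s₀ + z) = (z - (((ρ - 1 : ℝ) : ℂ) + s₀)) * ψ z := by
  set sρ : ℂ := ((ρ - 1 : ℝ) : ℂ) + s₀ with hsρ
  set f : ℂ → ℂ := fun z => χ.LFunction (1 - s₀ + z) with hf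
  have hLd := DirichletCharacter.differentiable_LFunction hχ1
  have hfd : Differentiable ℂ f := fun z => (hLd _).comp z (by fun_prop)
  have hρeq : 1 - s₀ + sρ = (ρ : ℂ) := by rw [hsρ]; push_cast; ring
  have hfρ : f sρ = 0 := by simp only [hf, hρeq, hLρ]
  have hderiv : deriv f sρ = deriv χ.LFunction ρ := by
    have h1 : HasDerivAt (fun z : ℂ => 1 - s₀ + z) 1 sρ := by
      simpa using (hasDerivAt_id sρ).const_add (1 - s₀)
    have h2 : HasDerivAt χ.LFunction (deriv χ.LFunction (1 - s₀ + sρ)) (1 - s₀ + sρ) :=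
      (hLd _).hasDerivAt
    have h3 : HasDerivAt f (deriv χ.LFunction (1 - s₀ + sρ) * 1) sρ := h2.comp sρ h1
    rw [mul_one] at h3
    rw [h3.deriv, hρeq]
  refine ⟨dslope f sρ, ?_, ?_, fun z => ?_⟩
  · have h : DifferentiableOn ℂ (dslope f sρ) Set.univ := by
      rw [differentiableOn_dslope (Filter.univ_mem)]
      exact hfd.differentiableOn
    exact fun u => h.differentiableAt (Filter.univ_mem)
  · rw [dslope_same, hderiv]
  · have h := sub_smul_dslope f sρ z
    rw [smul_eq_mul, hfρ, sub_zero] at h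
    exact h.symm

/-! ### The two simple-pole limits of `G = Φ·K_Y`, `K_Y(s) = Y^s ω₁(s)/s` -/

/-- **The pole of the kernel at `s = 0`**: if `Φ` is continuous at `0` then
`(z − 0)·Φ(z)K_Y(z) → Φ(0)` as `z → 0`, `z ≠ 0` (`Y^0ω₁(0) = 1`). [cite: Zhang2022LandauSiegel, §4 (4.1)] -/
theorem tendsto_mul_G_zero (hY : 0 < Y) (Λ : ℝ) {Φ : ℂ → ℂ} (hΦc : ContinuousAt Φ 0) :
    Tendsto (fun z : ℂ => (z - 0) * (Φ z *
        ((Y : ℂ) ^ (z + 0) * omega1 Λ (z + 0) / (z + 0)))) (𝓝[≠] 0) (𝓝 (Φ 0)) := by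
  have hnum : Continuous fun z : ℂ => (Y : ℂ) ^ (z + 0) * omega1 Λ (z + 0) :=
    (differentiable_kernel_num hY Λ 0).continuous
  have hlim : Tendsto (fun z : ℂ => Φ z * ((Y : ℂ) ^ (z + 0) * omega1 Λ (z + 0))) (𝓝[≠] 0)
      (𝓝 (Φ 0)) := by
    have hc : ContinuousAt (fun z : ℂ => Φ z * ((Y : ℂ) ^ (z + 0) * omega1 Λ (z + 0))) 0 :=
      hΦc.mul hnum.continuousAt
    have h : Tendsto (fun z : ℂ => Φ z * ((Y : ℂ) ^ (z + 0) * omega1 Λ (z + 0))) (𝓝 0)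
        (𝓝 (Φ 0 * ((Y : ℂ) ^ ((0 : ℂ) + 0) * omega1 Λ ((0 : ℂ) + 0)))) := hc.tendsto
    have h0 : Φ 0 * ((Y : ℂ) ^ ((0 : ℂ) + 0) * omega1 Λ ((0 : ℂ) + 0)) = Φ 0 := by
      rw [show ((0 : ℂ) + 0) = -0 + 0 by ring, kernel_num_at_neg, mul_one]
    rw [h0] at h
    exact h.mono_left nhdsWithin_le_nhds
  refine hlim.congr' ?_
  filter_upwards [self_mem_nhdsWithin] with z hz
  have hz0 : (z : ℂ) ≠ 0 := hz
  simp only [add_zero, sub_zero]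
  field_simp

/-- **The pole at `s_ρ = ρ − 1 + s₀`** (the zero `ρ` of `L(·,χ)` seen through `u = 1 − s₀ + s`): with
`L(1−s₀+z) = (z−s_ρ)ψ(z)`, `ψ(s_ρ) ≠ 0`, `U` continuous at `ρ` and `s_ρ ≠ 0`,
`(z − s_ρ)·Φ(z)K_Y(z) → U(ρ)L(ρ+β_a)L(ρ+β_b)/ψ(s_ρ)·K_Y(s_ρ)` (`z → s_ρ`, `z ≠ s_ρ`).
[cite: Zhang2022LandauSiegel, §12 proof of Lemma 12.2, p. 69] -/
theorem tendsto_mul_G_pole (hχ1 : χ ≠ 1) (hY : 0 < Y) (Λ : ℝ)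
    (hΦ : ∀ s, Φ s = U (1 - s₀ + s) * χ.LFunction (1 - s₀ + s + βa) *
      χ.LFunction (1 - s₀ + s + βb) / χ.LFunction (1 - s₀ + s))
    {ψ : ℂ → ℂ} (hψ : Differentiable ℂ ψ)
    (hfac : ∀ z, χ.LFunction (1 - s₀ + z) = (z - (((ρ - 1 : ℝ) : ℂ) + s₀)) * ψ z)
    (hψρ : ψ (((ρ - 1 : ℝ) : ℂ) + s₀) ≠ 0)
    (hUc : ContinuousAt U (ρ : ℂ)) (hsρ0 : ((ρ - 1 : ℝ) : ℂ) + s₀ ≠ 0) :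
    Tendsto (fun z : ℂ => (z - (((ρ - 1 : ℝ) : ℂ) + s₀)) * (Φ z *
        ((Y : ℂ) ^ (z + 0) * omega1 Λ (z + 0) / (z + 0))))
      (𝓝[≠] (((ρ - 1 : ℝ) : ℂ) + s₀))
      (𝓝 (U ρ * χ.LFunction (ρ + βa) * χ.LFunction (ρ + βb) / ψ (((ρ - 1 : ℝ) : ℂ) + s₀) *
        ((Y : ℂ) ^ ((((ρ - 1 : ℝ) : ℂ) + s₀) + 0) * omega1 Λ ((((ρ - 1 : ℝ) : ℂ) + s₀) + 0) /
          ((((ρ - 1 : ℝ) : ℂ) + s₀) + 0)))) := by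
  set sρ : ℂ := ((ρ - 1 : ℝ) : ℂ) + s₀ with hsρ
  have hρeq : 1 - s₀ + sρ = (ρ : ℂ) := by rw [hsρ]; push_cast; ring
  have hLd := DirichletCharacter.differentiable_LFunction hχ1
  -- the regular function `h(z) = U(w)L(w+βa)L(w+βb)/ψ(z)·K(z)`
  set h : ℂ → ℂ := fun z => U (1 - s₀ + z) * χ.LFunction (1 - s₀ + z + βa) *
      χ.LFunction (1 - s₀ + z + βb) / ψ z *
    ((Y : ℂ) ^ (z + 0) * omega1 Λ (z + 0) / (z + 0)) with hh
  have hcont : ContinuousAt h sρ := by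
    have hw : Continuous fun z : ℂ => 1 - s₀ + z := by fun_prop
    have hU' : ContinuousAt (fun z : ℂ => U (1 - s₀ + z)) sρ := by
      have : ContinuousAt U (1 - s₀ + sρ) := by rw [hρeq]; exact hUc
      exact ContinuousAt.comp this hw.continuousAt
    have h1 : ContinuousAt (fun z : ℂ => χ.LFunction (1 - s₀ + z + βa)) sρ :=
      ((hLd _).continuousAt).comp (by fun_prop : Continuous fun z : ℂ => 1 - s₀ + z + βa).continuousAt
    have h2 : ContinuousAt (fun z : ℂ => χ.LFunction (1 - s₀ + z + βb)) sρ :=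
      ((hLd _).continuousAt).comp (by fun_prop : Continuous fun z : ℂ => 1 - s₀ + z + βb).continuousAt
    have h3 : ContinuousAt ψ sρ := (hψ sρ).continuousAt
    have h4 : ContinuousAt (fun z : ℂ => (Y : ℂ) ^ (z + 0) * omega1 Λ (z + 0) / (z + 0)) sρ :=
      (differentiableAt_kernel hY Λ (by rw [add_zero]; exact hsρ0)).continuousAt
    exact (((hU'.mul h1).mul h2).div h3 hψρ).mul h4
  have hval : h sρ = U ρ * χ.LFunction (ρ + βa) * χ.LFunction (ρ + βb) / ψ sρ *
      ((Y : ℂ) ^ (sρ + 0) * omega1 Λ (sρ + 0) / (sρ + 0)) := by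
    simp only [hh, hρeq]
  rw [← hval]
  refine (hcont.tendsto.mono_left nhdsWithin_le_nhds).congr' ?_
  filter_upwards [self_mem_nhdsWithin] with z hz
  have hzρ : z - sρ ≠ 0 := sub_ne_zero.mpr hz
  simp only [hh, hΦ z, hfac z]
  field_simp


/-! ### Landau's broken line for `G = Φ·K_Y`: the line `Re s = 1` against the residues at `0`, `s_ρ` -/

/-- **The shifted big contour** (the step "in a way similar to the proof of Lemma 8.4" of u025/u030, generic
in `Y > 0`, `Λ > 0` and the shift `s₀`): with the data above (`0 < η ≤ 1/40`, `H ≥ 2`, `‖s₀‖ ≤ η/10`,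
`s_ρ = ρ − 1 + s₀ ≠ 0`), Landau's rectangle `[−η, 1] × [−H, H]` for `G(s) = Φ(s)·Y^sω₁(s)/s` contains
exactly the simple poles `0` and `s_ρ`, and
`‖(1/2π)∫_ℝ G(1+it)dt − (Φ(0) + U(ρ)L(ρ+β_a)L(ρ+β_b)/L′(ρ)·Y^{s_ρ}ω₁(s_ρ)/s_ρ)‖ ≤ (1/2π)(E_tails + E_left + 2E_horiz)`,
the three pieces being those of the tree's `GaussKernelContour.norm_lineIntegral_sub_sum_limUnder_le` at
`β = 0`, `σ₀ = 1`, `a = −η`, `M₀ = 27M_U`, `M₁ = M_UB_L²M_inv(1+4/η)`, `M₂ = 3M_UB_L²M_inv` — the shape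
consumed verbatim by `GaussKernelContour.remainder_le_eps1` (`η = c₁/𝓛`, `H ≥ 𝓛²⁰`, `Λ = 𝓛³⁰`,
`T ≤ Y ≤ P`: total `O(B·exp{−(c₁/2)𝓛^{1/10}})`). [cite: Zhang2022LandauSiegel, §12 proofs of Lemmas 12.2–12.3, pp. 69–70]
[cite: MontgomeryVaughan2007, §6.2] -/
theorem norm_vline_sub_residues_le (hχ1 : χ ≠ 1) {Λ : ℝ} (hΛ : 0 < Λ) (hY : 0 < Y)
    (hη : 0 < η) (hη40 : η ≤ 1 / 40) (hH : 2 ≤ H) (hs₀ : ‖s₀‖ ≤ η / 10)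
    (hβa : βa.re = 0) (hβa1 : ‖βa‖ ≤ 1 / 2) (hβb : βb.re = 0) (hβb1 : ‖βb‖ ≤ 1 / 2)
    (hUd : DifferentiableOn ℂ U {s : ℂ | 9 / 10 < s.re})
    (hΦ : ∀ s, Φ s = U (1 - s₀ + s) * χ.LFunction (1 - s₀ + s + βa) *
      χ.LFunction (1 - s₀ + s + βb) / χ.LFunction (1 - s₀ + s))
    (hMU : 0 ≤ MU) (hU : ∀ w : ℂ, 1 - 2 * η ≤ w.re → ‖U w‖ ≤ MU) (hBL : 0 ≤ BL)
    (hL : ∀ w : ℂ, 1 - 2 * η ≤ w.re → ‖w‖ ≤ H + 4 → ‖χ.LFunction w‖ ≤ BL) (hMinv : 0 ≤ Minv)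
    (hpack : ∀ w : ℂ, 1 - 2 * η ≤ w.re → |w.im| ≤ H + 1 → w ≠ (ρ : ℂ) →
      χ.LFunction w ≠ 0 ∧ ‖(χ.LFunction w)⁻¹‖ ≤ Minv * (1 + ‖w - ρ‖⁻¹))
    (hρ1 : ρ < 1) (hρη : 1 - η / 4 ≤ ρ) (hLρ : χ.LFunction ρ = 0) (hL'ρ : deriv χ.LFunction ρ ≠ 0)
    (hsρ0 : ((ρ - 1 : ℝ) : ℂ) + s₀ ≠ 0) :
    ‖(1 / (2 * π) : ℂ) * (∫ t : ℝ, Φ (((1 : ℝ) : ℂ) + t * I) *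
          ((Y : ℂ) ^ (((1 : ℝ) : ℂ) + t * I + 0) * omega1 Λ (((1 : ℝ) : ℂ) + t * I + 0) /
            (((1 : ℝ) : ℂ) + t * I + 0))) -
        (Φ 0 + U ρ * χ.LFunction (ρ + βa) * χ.LFunction (ρ + βb) / deriv χ.LFunction ρ *
          ((Y : ℂ) ^ ((((ρ - 1 : ℝ) : ℂ) + s₀) + 0) * omega1 Λ ((((ρ - 1 : ℝ) : ℂ) + s₀) + 0) /
            ((((ρ - 1 : ℝ) : ℂ) + s₀) + 0)))‖ ≤
      1 / (2 * π) *
        (2 * ((27 * MU) * (Y ^ ((1 : ℝ) + (0 : ℂ).re) * rexp (((1 : ℝ) + (0 : ℂ).re) ^ 2 / (4 * Λ)) /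
              |(1 : ℝ) + (0 : ℂ).re|) *
            (gauss (4 * Λ)⁻¹ (H - |(0 : ℂ).im|) * (Real.sqrt (4 * π * Λ) / 2))) +
          (MU * BL * BL * (Minv * (1 + 4 / η))) *
              (Y ^ (-η + (0 : ℂ).re) * rexp ((-η + (0 : ℂ).re) ^ 2 / (4 * Λ)) / |-η + (0 : ℂ).re|) *
            Real.sqrt (4 * π * Λ) +
          2 * (((1 : ℝ) - -η) * ((MU * BL * BL * (Minv * 3)) *
            (max (Y ^ (-η + (0 : ℂ).re)) (Y ^ ((1 : ℝ) + (0 : ℂ).re)) *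
            rexp (max ((-η + (0 : ℂ).re) ^ 2) (((1 : ℝ) + (0 : ℂ).re) ^ 2) / (4 * Λ)) *
            gauss (4 * Λ)⁻¹ (H - |(0 : ℂ).im|) / (H - |(0 : ℂ).im|))))) := by
  classical
  set sρ : ℂ := ((ρ - 1 : ℝ) : ℂ) + s₀ with hsρdef
  have hη1 : η ≤ 1 := by linarith
  have hH0 : 0 ≤ H := by linarith
  have hβa1' : ‖βa‖ ≤ 1 := by linarith
  have hβb1' : ‖βb‖ ≤ 1 := by linarith
  obtain ⟨hre₀, him₀⟩ := abs_re_im_le s₀ hs₀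
  have hre₀' := abs_le.mp hre₀
  have him₀' := abs_le.mp him₀
  have hρeq : 1 - s₀ + sρ = (ρ : ℂ) := by rw [hsρdef]; push_cast; ring
  -- the zero-free half of the package
  have hzf : ∀ w : ℂ, 1 - 2 * η ≤ w.re → |w.im| ≤ H + 1 → w ≠ (ρ : ℂ) → χ.LFunction w ≠ 0 :=
    fun w h1 h2 h3 => (hpack w h1 h2 h3).1
  -- holomorphy of `Φ` off `sρ` in the box `Re z > −3η/2`, `|Im z| < H + 1/2`
  have hΦd : ∀ z : ℂ, -(3 * η / 2) < z.re → |z.im| < H + 1 / 2 → z ≠ sρ → DifferentiableAt ℂ Φ z := by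
    intro z hz1 hz2 hz3
    refine differentiableAt_Phi χ U Φ s₀ βa βb hχ1 hUd hΦ ?_ ?_
    · rw [(u_re_im s₀ z).1]; linarith
    · exact LFunction_ne_zero_of_box χ s₀ hs₀ hη1 hzf hz1.le hz2.le hz3
  -- the factorisation at `sρ`
  obtain ⟨ψ, hψd, hψρ, hfac⟩ := exists_factor_LFunction_shift χ s₀ (ρ := ρ) hχ1 hLρ
  have hψρ0 : ψ sρ ≠ 0 := by rw [hψρ]; exact hL'ρ
  -- the three sup bounds
  have hΦ₀ : ∀ t : ℝ, ‖Φ (((1 : ℝ) : ℂ) + t * I)‖ ≤ 27 * MU := fun t =>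
    (norm_Phi_right_le' χ U Φ s₀ βa βb hs₀ hη1 hβa hβb hΦ hMU (fun w hw => hU w (by linarith))
      (s := ((1 : ℝ) : ℂ) + t * I) (by simp)).2
  have hΦ₁ : ∀ t : ℝ, |t| ≤ H → ‖Φ (((-η : ℝ) : ℂ) + t * I)‖ ≤ MU * BL * BL * (Minv * (1 + 4 / η)) :=
    fun t ht => norm_Phi_left_le' χ U Φ s₀ βa βb hη hη1 hs₀ hβa hβa1' hβb hβb1' hΦ hMU hU hBL hL hMinv
      hpack hρη ht
  have hΦ₂ : ∀ u : ℝ, -η ≤ u → u ≤ (1 : ℝ) →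
      ‖Φ ((u : ℂ) + (H : ℂ) * I)‖ ≤ MU * BL * BL * (Minv * 3) ∧
        ‖Φ ((u : ℂ) + ((-H : ℝ) : ℂ) * I)‖ ≤ MU * BL * BL * (Minv * 3) := by
    intro u hu1 hu2
    refine ⟨?_, ?_⟩
    · have h := norm_Phi_horiz_le' χ U Φ s₀ βa βb hη hη1 hs₀ hH hβa hβa1' hβb hβb1' hΦ hMU hU hBL hL
        hMinv hpack hu1 hu2 (y := H) (abs_of_nonneg hH0)
      simpa using h
    · exact norm_Phi_horiz_le' χ U Φ s₀ βa βb hη hη1 hs₀ hH hβa hβa1' hβb hβb1' hΦ hMU hU hBL hL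
        hMinv hpack hu1 hu2 (y := -H) (by rw [abs_neg, abs_of_nonneg hH0])
  -- integrability on the line `Re s = 1`
  have hcont : Continuous fun t : ℝ => Φ (((1 : ℝ) : ℂ) + t * I) := by
    have hline : Continuous fun t : ℝ => ((1 : ℝ) : ℂ) + t * I := by fun_prop
    refine continuous_iff_continuousAt.2 fun t => ?_
    have hd : DifferentiableAt ℂ Φ (((1 : ℝ) : ℂ) + t * I) := by
      refine differentiableAt_Phi χ U Φ s₀ βa βb hχ1 hUd hΦ ?_ ?_
      · rw [(u_re_im s₀ _).1]; simp; linarith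
      · exact (norm_Phi_right_le' χ U Φ s₀ βa βb hs₀ hη1 hβa hβb hΦ hMU
          (fun w hw => hU w (by linarith)) (s := ((1 : ℝ) : ℂ) + t * I) (by simp)).1
    exact ContinuousAt.comp (g := Φ) (f := fun t : ℝ => ((1 : ℝ) : ℂ) + t * I) (x := t)
      hd.continuousAt hline.continuousAt
  have hint := integrable_integrand_line (Φ := Φ) (β := (0 : ℂ)) (Λ := Λ) hΛ hY (σ := (1 : ℝ))
    (M := 27 * MU) (by simp) hcont hΦ₀
  -- the rectangle data
  set S : Finset ℂ := {0, sρ} with hSdef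
  set W : Set ℂ := {z : ℂ | -(3 * η / 2) < z.re ∧ z.re < 3 / 2 ∧ |z.im| < H + 1 / 2} with hWdef
  have hWopen : IsOpen W := by
    have h1 : IsOpen {z : ℂ | -(3 * η / 2) < z.re} := isOpen_lt continuous_const Complex.continuous_re
    have h2 : IsOpen {z : ℂ | z.re < 3 / 2} := isOpen_lt Complex.continuous_re continuous_const
    have h3 : IsOpen {z : ℂ | |z.im| < H + 1 / 2} :=
      isOpen_lt (continuous_abs.comp Complex.continuous_im) continuous_const
    have : W = {z : ℂ | -(3 * η / 2) < z.re} ∩ ({z : ℂ | z.re < 3 / 2} ∩ {z : ℂ | |z.im| < H + 1 / 2}) := by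
      ext z; simp [hWdef]
    rw [this]
    exact h1.inter (h2.inter h3)
  have hKW : Icc (-η) (1 : ℝ) ×ℂ Icc (-H) H ⊆ W := by
    intro z hz
    rw [Complex.mem_reProdIm, Set.mem_Icc, Set.mem_Icc] at hz
    refine ⟨by linarith [hz.1.1], by linarith [hz.1.2], ?_⟩
    rw [abs_lt]; constructor <;> linarith [hz.2.1, hz.2.2]
  have hS : (S : Set ℂ) ⊆ Ioo (-η) (1 : ℝ) ×ℂ Ioo (-H) H := by
    intro z hz
    rw [hSdef, Finset.coe_insert, Finset.coe_singleton, Set.mem_insert_iff, Set.mem_singleton_iff] at hz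
    rw [Complex.mem_reProdIm, Set.mem_Ioo, Set.mem_Ioo]
    rcases hz with rfl | rfl
    · simp only [Complex.zero_re, Complex.zero_im]
      refine ⟨⟨by linarith, by norm_num⟩, by linarith, by linarith⟩
    · have hre : sρ.re = ρ - 1 + s₀.re := by simp [hsρdef]
      have him : sρ.im = s₀.im := by simp [hsρdef]
      rw [hre, him]
      refine ⟨⟨by linarith, by linarith⟩, by linarith, by linarith⟩
  have hG : DifferentiableOn ℂ (fun s => Φ s *
      ((Y : ℂ) ^ (s + 0) * omega1 Λ (s + 0) / (s + 0))) (W \ ↑S) := by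
    intro z hz
    have hzW : z ∈ W := hz.1
    have hzS : z ∉ (S : Set ℂ) := hz.2
    rw [hSdef, Finset.coe_insert, Finset.coe_singleton, Set.mem_insert_iff, Set.mem_singleton_iff,
      not_or] at hzS
    have h1 : DifferentiableAt ℂ Φ z := hΦd z hzW.1 hzW.2.2 hzS.2
    have h2 : DifferentiableAt ℂ (fun s : ℂ => (Y : ℂ) ^ (s + 0) * omega1 Λ (s + 0) / (s + 0)) z :=
      differentiableAt_kernel hY Λ (by rw [add_zero]; exact hzS.1)
    exact (h1.mul h2).differentiableWithinAt
  -- the pole limits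
  have hΦc0 : ContinuousAt Φ 0 := by
    have h0S : (0 : ℂ) ≠ sρ := fun h => hsρ0 (by rw [hsρdef] at h; exact h.symm)
    exact (hΦd 0 (by simp; linarith) (by simp; linarith) h0S).continuousAt
  have hUc : ContinuousAt U (ρ : ℂ) := by
    have hopen : IsOpen {s : ℂ | 9 / 10 < s.re} := isOpen_lt continuous_const Complex.continuous_re
    have hρ9 : (9 : ℝ) / 10 < (ρ : ℂ).re := by simp; linarith
    exact (hUd.differentiableAt (hopen.mem_nhds hρ9)).continuousAt
  have hlim0 := tendsto_mul_G_zero (Φ := Φ) hY Λ hΦc0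
  have hlimρ := tendsto_mul_G_pole χ U Φ s₀ βa βb hχ1 hY Λ hΦ hψd hfac hψρ0 hUc hsρ0
  have hlim : ∀ p ∈ S, ∃ r : ℂ, Tendsto (fun z => (z - p) * (Φ z *
      ((Y : ℂ) ^ (z + 0) * omega1 Λ (z + 0) / (z + 0)))) (𝓝[≠] p) (𝓝 r) := by
    intro p hp
    rw [hSdef, Finset.mem_insert, Finset.mem_singleton] at hp
    rcases hp with rfl | rfl
    · exact ⟨_, hlim0⟩
    · exact ⟨_, hlimρ⟩
  -- the engine
  have hmain := norm_lineIntegral_sub_sum_limUnder_le (Φ := Φ) (β := (0 : ℂ)) hΛ hY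
    (a := -η) (σ₀ := (1 : ℝ)) (H := H) (M₀ := 27 * MU) (M₁ := MU * BL * BL * (Minv * (1 + 4 / η)))
    (M₂ := MU * BL * BL * (Minv * 3)) (by linarith) (by simp; linarith) (by simp; linarith) (by simp)
    (by positivity) (by positivity) (by positivity) (fun t _ => hΦ₀ t) hΦ₁ hΦ₂ hint S W hWopen hKW hS
    hG hlim
  -- the residues
  have h0ρ : (0 : ℂ) ≠ sρ := fun h => hsρ0 (by rw [hsρdef] at h; exact h.symm)
  rw [hSdef, Finset.sum_pair h0ρ, hlim0.limUnder_eq, hlimρ.limUnder_eq, hψρ] at hmain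
  exact hmain


/-! ### The small circle: the same two residues (so the circle route of `Section12ShiftedSmallCircle` plugs) -/

open Metric in
/-- **Two simple poles inside a circle** (general centre; cf. `Typed.Sec12B.circ_two_poles`): for `g`
holomorphic on the closed disc `|z − c| ≤ R` and `p₁ ≠ p₂` in the open disc,
`(2πi)⁻¹∮_{C(c,R)} g(z)/((z − p₁)(z − p₂)) dz = (g(p₁) − g(p₂))/(p₁ − p₂)` (partial fractions and Cauchy's
integral formula twice). [cite: Zhang2022LandauSiegel, §12 proof of Lemma 12.3, p. 70 ("direct calculation")] -/
theorem circ_two_poles_center {c p₁ p₂ : ℂ} {R : ℝ} (hp : p₁ ≠ p₂) (h₁ : p₁ ∈ ball c R)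
    (h₂ : p₂ ∈ ball c R) {g : ℂ → ℂ} (hg : DifferentiableOn ℂ g (closedBall c R)) :
    (2 * π * I)⁻¹ * (∮ z in C(c, R), g z / ((z - p₁) * (z - p₂))) = (g p₁ - g p₂) / (p₁ - p₂) := by
  have hR : 0 < R := lt_of_le_of_lt dist_nonneg (mem_ball.mp h₁)
  have hp' : p₁ - p₂ ≠ 0 := sub_ne_zero.mpr hp
  have hsph : ∀ z ∈ sphere c R, z - p₁ ≠ 0 ∧ z - p₂ ≠ 0 := by
    intro z hz
    have hzR : dist z c = R := mem_sphere.mp hz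
    constructor
    · intro h; rw [sub_eq_zero] at h; rw [h] at hzR; have := mem_ball.mp h₁; linarith
    · intro h; rw [sub_eq_zero] at h; rw [h] at hzR; have := mem_ball.mp h₂; linarith
  have hcongr : (∮ z in C(c, R), g z / ((z - p₁) * (z - p₂))) =
      ∮ z in C(c, R), (p₁ - p₂)⁻¹ • ((z - p₁)⁻¹ • g z - (z - p₂)⁻¹ • g z) := by
    refine circleIntegral.integral_congr hR.le fun z hz => ?_
    obtain ⟨hz1, hz2⟩ := hsph z hz
    simp only [smul_eq_mul]
    field_simp
    ring
  have hgc : ContinuousOn g (sphere c R) := hg.continuousOn.mono sphere_subset_closedBall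
  have hci : ∀ v : ℂ, v ∈ ball c R → CircleIntegrable (fun z => (z - v)⁻¹ • g z) c R := by
    intro v hv
    refine ContinuousOn.circleIntegrable hR.le ?_
    have hinv : ContinuousOn (fun z : ℂ => (z - v)⁻¹) (sphere c R) := by
      refine ContinuousOn.inv₀ (continuousOn_id.sub continuousOn_const) fun z hz => ?_
      have hzR : dist z c = R := mem_sphere.mp hz
      have hvR : dist v c < R := mem_ball.mp hv
      intro h
      rw [sub_eq_zero] at h
      rw [h] at hzR
      linarith
    exact hinv.smul hgc
  rw [hcongr, circleIntegral.integral_smul, circleIntegral.integral_sub (hci _ h₁) (hci _ h₂),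
    hg.circleIntegral_sub_inv_smul h₁, hg.circleIntegral_sub_inv_smul h₂]
  simp only [smul_eq_mul]
  have h2pi : (2 * π * I : ℂ) ≠ 0 := by simp [Real.pi_ne_zero, Complex.I_ne_zero]
  field_simp

open Metric in
/-- **The small circle carries the same residues.** Under the data of `norm_vline_sub_residues_le`, for a
circle `C(c, R)` with `‖c‖ + R ≤ η` containing `0` and `s_ρ` in its interior (for u025/u030:
`c = β₆ − w`, `R = 3α`, zl-w12-p8's circle), `(2πi)⁻¹∮_{C(c,R)} Φ(z)·Y^zω₁(z)/z dz
= Φ(0) + U(ρ)L(ρ+β_a)L(ρ+β_b)/L′(ρ)·Y^{s_ρ}ω₁(s_ρ)/s_ρ` — the two numbers that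
`norm_vline_sub_residues_le` compares the line integral with; hence the line integral equals the small
circle integral up to Landau's remainder (`norm_vline_sub_circ_le`), and the circle is then evaluated by
`Lemma84.norm_circ_true_sub_main_kernel1/2`. [cite: Zhang2022LandauSiegel, §12 proofs of Lemmas 12.2–12.3, pp. 69–70] -/
theorem circ_eq_residues (hχ1 : χ ≠ 1) (hY : 0 < Y) (Λ : ℝ)
    (hη : 0 < η) (hη40 : η ≤ 1 / 40) (hH : 2 ≤ H) (hs₀ : ‖s₀‖ ≤ η / 10)
    (hUd : DifferentiableOn ℂ U {s : ℂ | 9 / 10 < s.re})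
    (hΦ : ∀ s, Φ s = U (1 - s₀ + s) * χ.LFunction (1 - s₀ + s + βa) *
      χ.LFunction (1 - s₀ + s + βb) / χ.LFunction (1 - s₀ + s))
    (hpack : ∀ w : ℂ, 1 - 2 * η ≤ w.re → |w.im| ≤ H + 1 → w ≠ (ρ : ℂ) →
      χ.LFunction w ≠ 0 ∧ ‖(χ.LFunction w)⁻¹‖ ≤ Minv * (1 + ‖w - ρ‖⁻¹))
    (hLρ : χ.LFunction ρ = 0) (hL'ρ : deriv χ.LFunction ρ ≠ 0)
    (hsρ0 : ((ρ - 1 : ℝ) : ℂ) + s₀ ≠ 0) {c : ℂ} {R : ℝ} (hcR : ‖c‖ + R ≤ η)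
    (h0 : (0 : ℂ) ∈ ball c R) (hρR : (((ρ - 1 : ℝ) : ℂ) + s₀) ∈ ball c R) :
    (2 * π * I)⁻¹ * (∮ z in C(c, R), Φ z * ((Y : ℂ) ^ (z + 0) * omega1 Λ (z + 0) / (z + 0))) =
      Φ 0 + U ρ * χ.LFunction (ρ + βa) * χ.LFunction (ρ + βb) / deriv χ.LFunction ρ *
        ((Y : ℂ) ^ ((((ρ - 1 : ℝ) : ℂ) + s₀) + 0) * omega1 Λ ((((ρ - 1 : ℝ) : ℂ) + s₀) + 0) /
          ((((ρ - 1 : ℝ) : ℂ) + s₀) + 0)) := by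
  set sρ : ℂ := ((ρ - 1 : ℝ) : ℂ) + s₀ with hsρdef
  have hη1 : η ≤ 1 := by linarith
  have hR : 0 < R := lt_of_le_of_lt dist_nonneg (mem_ball.mp h0)
  have hρeq : 1 - s₀ + sρ = (ρ : ℂ) := by rw [hsρdef]; push_cast; ring
  have hzf : ∀ w : ℂ, 1 - 2 * η ≤ w.re → |w.im| ≤ H + 1 → w ≠ (ρ : ℂ) → χ.LFunction w ≠ 0 :=
    fun w h1 h2 h3 => (hpack w h1 h2 h3).1
  have hLd := DirichletCharacter.differentiable_LFunction hχ1
  -- points of the closed disc lie in the box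
  have hdisc : ∀ z ∈ closedBall c R, -(3 * η / 2) < z.re ∧ |z.im| < H + 1 / 2 ∧ 9 / 10 < (1 - s₀ + z).re := by
    intro z hz
    have hz' : ‖z‖ ≤ η := by
      have h1 : ‖z - c‖ ≤ R := mem_closedBall_iff_norm.mp hz
      calc ‖z‖ = ‖(z - c) + c‖ := by ring_nf
        _ ≤ ‖z - c‖ + ‖c‖ := norm_add_le _ _
        _ ≤ R + ‖c‖ := by gcongr
        _ ≤ η := by linarith
    have hre := (abs_le.mp ((Complex.abs_re_le_norm z).trans hz'))
    have him := (Complex.abs_im_le_norm z).trans hz'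
    obtain ⟨hre₀, -⟩ := abs_re_im_le s₀ hs₀
    have hre₀' := abs_le.mp hre₀
    refine ⟨by linarith, by linarith, ?_⟩
    rw [(u_re_im s₀ z).1]; linarith
  -- the factorisation and `ψ ≠ 0` on the disc
  obtain ⟨ψ, hψd, hψρ, hfac⟩ := exists_factor_LFunction_shift χ s₀ (ρ := ρ) hχ1 hLρ
  rw [← hsρdef] at hψρ
  simp only [← hsρdef] at hfac
  have hψne : ∀ z ∈ closedBall c R, ψ z ≠ 0 := by
    intro z hz
    by_cases hzρ : z = sρ
    · rw [hzρ, hψρ]; exact hL'ρ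
    · obtain ⟨h1, h2, -⟩ := hdisc z hz
      have hL := LFunction_ne_zero_of_box χ s₀ hs₀ hη1 hzf h1.le h2.le hzρ
      rw [hfac z] at hL
      exact right_ne_zero_of_mul hL
  -- the regular numerator `g`
  set g : ℂ → ℂ := fun z => U (1 - s₀ + z) * χ.LFunction (1 - s₀ + z + βa) *
      χ.LFunction (1 - s₀ + z + βb) / ψ z * ((Y : ℂ) ^ (z + 0) * omega1 Λ (z + 0)) with hgdef
  have hgd : DifferentiableOn ℂ g (closedBall c R) := by
    intro z hz
    obtain ⟨-, -, h9⟩ := hdisc z hz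
    have hopen : IsOpen {s : ℂ | 9 / 10 < s.re} := isOpen_lt continuous_const Complex.continuous_re
    have hw : DifferentiableAt ℂ (fun z : ℂ => 1 - s₀ + z) z := by fun_prop
    have hU' : DifferentiableAt ℂ (fun z : ℂ => U (1 - s₀ + z)) z :=
      (hUd.differentiableAt (hopen.mem_nhds h9)).comp z hw
    have h1 : DifferentiableAt ℂ (fun z : ℂ => χ.LFunction (1 - s₀ + z + βa)) z :=
      (hLd _).comp z (by fun_prop)
    have h2 : DifferentiableAt ℂ (fun z : ℂ => χ.LFunction (1 - s₀ + z + βb)) z :=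
      (hLd _).comp z (by fun_prop)
    have h3 : DifferentiableAt ℂ (fun z : ℂ => (Y : ℂ) ^ (z + 0) * omega1 Λ (z + 0)) z :=
      differentiable_kernel_num hY Λ 0 z
    exact ((((hU'.mul h1).mul h2).div (hψd z) (hψne z hz)).mul h3).differentiableWithinAt
  -- `Φ·K = g/((z − sρ)(z − 0))` on the circle
  have h0R : (0 : ℂ) ∈ ball c R := h0
  have hcongr : (∮ z in C(c, R), Φ z * ((Y : ℂ) ^ (z + 0) * omega1 Λ (z + 0) / (z + 0))) =
      ∮ z in C(c, R), g z / ((z - sρ) * (z - 0)) := by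
    refine circleIntegral.integral_congr hR.le fun z hz => ?_
    have hzR : dist z c = R := mem_sphere.mp hz
    have hz0 : z ≠ 0 := by
      intro h; rw [h] at hzR; have := mem_ball.mp h0R; linarith
    have hzρ : z - sρ ≠ 0 := by
      intro h; rw [sub_eq_zero] at h; rw [h] at hzR; have := mem_ball.mp hρR; linarith
    have hψz : ψ z ≠ 0 := hψne z (sphere_subset_closedBall hz)
    simp only [hgdef, hΦ z, hfac z, add_zero, sub_zero]
    field_simp
  rw [hcongr, circ_two_poles_center (c := c) (R := R) hsρ0 hρR h0R hgd]
  -- evaluate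
  have hψ0 : ψ 0 ≠ 0 := hψne 0 (ball_subset_closedBall h0R)
  have hd0 : deriv χ.LFunction ρ ≠ 0 := hL'ρ
  have hL0 : χ.LFunction (1 - s₀ + 0) = (0 - sρ) * ψ 0 := hfac 0
  have hker0 : (Y : ℂ) ^ ((0 : ℂ) + 0) * omega1 Λ ((0 : ℂ) + 0) = 1 := by
    rw [show ((0 : ℂ) + 0) = -0 + 0 by ring, kernel_num_at_neg]
  have hg0 : g 0 = U (1 - s₀ + 0) * χ.LFunction (1 - s₀ + 0 + βa) *
      χ.LFunction (1 - s₀ + 0 + βb) / ψ 0 := by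
    simp only [hgdef]; rw [hker0, mul_one]
  have hgρ : g sρ = U ρ * χ.LFunction (ρ + βa) * χ.LFunction (ρ + βb) / deriv χ.LFunction ρ *
      ((Y : ℂ) ^ (sρ + 0) * omega1 Λ (sρ + 0)) := by
    simp only [hgdef]; rw [hρeq, hψρ]
  rw [hg0, hgρ, hΦ 0, hL0]
  have hsρ0' : sρ ≠ 0 := hsρ0
  simp only [add_zero, sub_zero, zero_sub]
  field_simp
  ring


open Metric in
/-- **Line integral versus small circle** (the form consumed with zl-w12-p8's
`Lemma84.norm_circ_true_sub_main_kernel1/2`): under the hypotheses of `norm_vline_sub_residues_le` and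
for a circle `C(c,R)` with `‖c‖ + R ≤ η` containing `0` and `s_ρ` in its interior,
`‖(1/2π)∫_ℝ Φ(1+it)K_Y(1+it)dt − (2πi)⁻¹∮_{C(c,R)} Φ(z)K_Y(z)dz‖ ≤ (1/2π)(E_tails + E_left + 2E_horiz)`
(same explicit remainder). [cite: Zhang2022LandauSiegel, §12 proofs of Lemmas 12.2–12.3, pp. 69–70]
[cite: MontgomeryVaughan2007, §6.2] -/
theorem norm_vline_sub_circ_le (hχ1 : χ ≠ 1) {Λ : ℝ} (hΛ : 0 < Λ) (hY : 0 < Y)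
    (hη : 0 < η) (hη40 : η ≤ 1 / 40) (hH : 2 ≤ H) (hs₀ : ‖s₀‖ ≤ η / 10)
    (hβa : βa.re = 0) (hβa1 : ‖βa‖ ≤ 1 / 2) (hβb : βb.re = 0) (hβb1 : ‖βb‖ ≤ 1 / 2)
    (hUd : DifferentiableOn ℂ U {s : ℂ | 9 / 10 < s.re})
    (hΦ : ∀ s, Φ s = U (1 - s₀ + s) * χ.LFunction (1 - s₀ + s + βa) *
      χ.LFunction (1 - s₀ + s + βb) / χ.LFunction (1 - s₀ + s))
    (hMU : 0 ≤ MU) (hU : ∀ w : ℂ, 1 - 2 * η ≤ w.re → ‖U w‖ ≤ MU) (hBL : 0 ≤ BL)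
    (hL : ∀ w : ℂ, 1 - 2 * η ≤ w.re → ‖w‖ ≤ H + 4 → ‖χ.LFunction w‖ ≤ BL) (hMinv : 0 ≤ Minv)
    (hpack : ∀ w : ℂ, 1 - 2 * η ≤ w.re → |w.im| ≤ H + 1 → w ≠ (ρ : ℂ) →
      χ.LFunction w ≠ 0 ∧ ‖(χ.LFunction w)⁻¹‖ ≤ Minv * (1 + ‖w - ρ‖⁻¹))
    (hρ1 : ρ < 1) (hρη : 1 - η / 4 ≤ ρ) (hLρ : χ.LFunction ρ = 0) (hL'ρ : deriv χ.LFunction ρ ≠ 0)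
    (hsρ0 : ((ρ - 1 : ℝ) : ℂ) + s₀ ≠ 0) {c : ℂ} {R : ℝ} (hcR : ‖c‖ + R ≤ η)
    (h0 : (0 : ℂ) ∈ ball c R) (hρR : (((ρ - 1 : ℝ) : ℂ) + s₀) ∈ ball c R) :
    ‖(1 / (2 * π) : ℂ) * (∫ t : ℝ, Φ (((1 : ℝ) : ℂ) + t * I) *
          ((Y : ℂ) ^ (((1 : ℝ) : ℂ) + t * I + 0) * omega1 Λ (((1 : ℝ) : ℂ) + t * I + 0) /
            (((1 : ℝ) : ℂ) + t * I + 0))) -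
        (2 * π * I)⁻¹ * (∮ z in C(c, R), Φ z * ((Y : ℂ) ^ (z + 0) * omega1 Λ (z + 0) / (z + 0)))‖ ≤
      1 / (2 * π) *
        (2 * ((27 * MU) * (Y ^ ((1 : ℝ) + (0 : ℂ).re) * rexp (((1 : ℝ) + (0 : ℂ).re) ^ 2 / (4 * Λ)) /
              |(1 : ℝ) + (0 : ℂ).re|) *
            (gauss (4 * Λ)⁻¹ (H - |(0 : ℂ).im|) * (Real.sqrt (4 * π * Λ) / 2))) +
          (MU * BL * BL * (Minv * (1 + 4 / η))) *
              (Y ^ (-η + (0 : ℂ).re) * rexp ((-η + (0 : ℂ).re) ^ 2 / (4 * Λ)) / |-η + (0 : ℂ).re|) *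
            Real.sqrt (4 * π * Λ) +
          2 * (((1 : ℝ) - -η) * ((MU * BL * BL * (Minv * 3)) *
            (max (Y ^ (-η + (0 : ℂ).re)) (Y ^ ((1 : ℝ) + (0 : ℂ).re)) *
            rexp (max ((-η + (0 : ℂ).re) ^ 2) (((1 : ℝ) + (0 : ℂ).re) ^ 2) / (4 * Λ)) *
            gauss (4 * Λ)⁻¹ (H - |(0 : ℂ).im|) / (H - |(0 : ℂ).im|))))) := by
  rw [circ_eq_residues χ U Φ s₀ βa βb hχ1 hY Λ hη hη40 hH hs₀ hUd hΦ hpack hLρ hL'ρ hsρ0 hcR h0 hρR]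
  exact norm_vline_sub_residues_le χ U Φ s₀ βa βb hχ1 hΛ hY hη hη40 hH hs₀ hβa hβa1 hβb hβb1 hUd hΦ
    hMU hU hBL hL hMinv hpack hρ1 hρη hLρ hL'ρ hsρ0


/-! ### E2″: removing `ω₁` on the small circle (the bare kernels of `Section12ShiftedSmallCircle`) -/

open Metric in
/-- **`ω₁`-removal on the small circle** (lane ruling S-8a (3), glue E2″): on `C(c,R)` with `‖c‖ < R`,
`(‖c‖+R)² ≤ 4Λ`, `Y ≥ 1`, and `‖Φ‖ ≤ M` on the circle,
`‖(2πi)⁻¹∮ Φ(z)Y^zω₁(z)/z dz − (2πi)⁻¹∮ Φ(z)Y^z/z dz‖ ≤ R·M·Y^{‖c‖+R}·2((‖c‖+R)²/(4Λ))/(R − ‖c‖)`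
(`|ω₁(z) − 1| = |e^{z²/4Λ} − 1| ≤ 2|z|²/(4Λ)`, `|Y^z| ≤ Y^{‖c‖+R}`, `|z| ≥ R − ‖c‖`). For u025/u030:
`c = β₆ − w`, `R = 3α`, `Λ = 𝓛³⁰`, `Y ≤ P` (`Y^{11α/2} ≤ e^{11π/2}`): the glue is `O(M·α²𝓛⁻³⁰)`, after which
zl-w12-p8's `Lemma84.norm_circ_true_sub_main_kernel1/2` (bare kernels `X₂^z/z`, `(X₂^z − X₁^z)/z`) apply.
[cite: Zhang2022LandauSiegel, §12 proofs of Lemmas 12.2–12.3, pp. 69–70] [cite: Zhang2022LandauSiegel, §4 (4.1)] -/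
theorem norm_circ_omega1_sub_le {Λ : ℝ} (hΛ : 0 < Λ) (hY1 : 1 ≤ Y) {c : ℂ} {R M : ℝ} (hcR : ‖c‖ < R)
    (hsmall : (‖c‖ + R) ^ 2 ≤ 4 * Λ) {Φ : ℂ → ℂ} (hΦc : ContinuousOn Φ (sphere c R))
    (hM : ∀ z ∈ sphere c R, ‖Φ z‖ ≤ M) :
    ‖(2 * π * I)⁻¹ * (∮ z in C(c, R), Φ z * ((Y : ℂ) ^ (z + 0) * omega1 Λ (z + 0) / (z + 0))) -
        (2 * π * I)⁻¹ * (∮ z in C(c, R), Φ z * ((Y : ℂ) ^ z / z))‖ ≤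
      R * (M * Y ^ (‖c‖ + R) * (2 * ((‖c‖ + R) ^ 2 / (4 * Λ))) / (R - ‖c‖)) := by
  have hR : 0 < R := lt_of_le_of_lt (norm_nonneg c) hcR
  have hY0 : 0 < Y := by linarith
  have hY0' : (Y : ℂ) ≠ 0 := ofReal_ne_zero.mpr hY0.ne'
  have hRc : 0 < R - ‖c‖ := by linarith
  -- geometry of the circle
  have hsph : ∀ z ∈ sphere c R, ‖z‖ ≤ ‖c‖ + R ∧ R - ‖c‖ ≤ ‖z‖ ∧ z ≠ 0 := by
    intro z hz
    have hzc : ‖z - c‖ = R := by rw [← dist_eq_norm]; exact mem_sphere.mp hz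
    have h1 : ‖z‖ ≤ ‖c‖ + R := by
      calc ‖z‖ = ‖(z - c) + c‖ := by ring_nf
        _ ≤ ‖z - c‖ + ‖c‖ := norm_add_le _ _
        _ = ‖c‖ + R := by rw [hzc]; ring
    have h2 : R - ‖c‖ ≤ ‖z‖ := by
      have h' : ‖z - c‖ ≤ ‖z‖ + ‖c‖ := norm_sub_le z c
      linarith
    refine ⟨h1, h2, ?_⟩
    intro h0
    rw [h0, norm_zero] at h2
    linarith
  have hM0 : 0 ≤ M := by
    have hpt : c + (R : ℂ) ∈ sphere c R := by simp [abs_of_pos hR]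
    exact le_trans (norm_nonneg _) (hM _ hpt)
  -- continuity / integrability on the circle
  have hω : Continuous fun w : ℂ => omega1 Λ w := by unfold omega1; fun_prop
  have hcpow : Continuous fun b : ℂ => (Y : ℂ) ^ b :=
    continuous_iff_continuousAt.mpr fun b => continuousAt_const_cpow hY0'
  have hk1 : ContinuousOn (fun z : ℂ => (Y : ℂ) ^ (z + 0) * omega1 Λ (z + 0) / (z + 0)) (sphere c R) := by
    refine ContinuousOn.div (by fun_prop) (by fun_prop) fun z hz => ?_
    rw [add_zero]; exact (hsph z hz).2.2
  have hk2 : ContinuousOn (fun z : ℂ => (Y : ℂ) ^ z / z) (sphere c R) :=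
    ContinuousOn.div hcpow.continuousOn continuousOn_id fun z hz => (hsph z hz).2.2
  have hi1 : CircleIntegrable (fun z => Φ z * ((Y : ℂ) ^ (z + 0) * omega1 Λ (z + 0) / (z + 0))) c R :=
    (hΦc.mul hk1).circleIntegrable hR.le
  have hi2 : CircleIntegrable (fun z => Φ z * ((Y : ℂ) ^ z / z)) c R :=
    (hΦc.mul hk2).circleIntegrable hR.le
  rw [← mul_sub, ← circleIntegral.integral_sub hi1 hi2, ← smul_eq_mul]
  refine circleIntegral.norm_two_pi_i_inv_smul_integral_le_of_norm_le_const hR.le fun z hz => ?_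
  obtain ⟨hz1, hz2, hz0⟩ := hsph z hz
  have hzpos : 0 < ‖z‖ := norm_pos_iff.mpr hz0
  -- the integrand difference `Φ(z)·Y^z(ω₁(z) − 1)/z`
  have hid : Φ z * ((Y : ℂ) ^ (z + 0) * omega1 Λ (z + 0) / (z + 0)) - Φ z * ((Y : ℂ) ^ z / z) =
      Φ z * (Y : ℂ) ^ z * (omega1 Λ z - 1) / z := by
    simp only [add_zero]; ring
  rw [hid, norm_div, norm_mul, norm_mul]
  -- the three factors
  have hYz : ‖(Y : ℂ) ^ z‖ ≤ Y ^ (‖c‖ + R) := by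
    rw [Complex.norm_cpow_eq_rpow_re_of_pos hY0]
    exact Real.rpow_le_rpow_of_exponent_le hY1 ((Complex.re_le_norm z).trans hz1)
  have hωz : ‖omega1 Λ z - 1‖ ≤ 2 * ((‖c‖ + R) ^ 2 / (4 * Λ)) := by
    have hx : ‖z ^ 2 / ((4 * Λ : ℝ) : ℂ)‖ ≤ (‖c‖ + R) ^ 2 / (4 * Λ) := by
      rw [norm_div, norm_pow, Complex.norm_of_nonneg (by positivity : (0 : ℝ) ≤ 4 * Λ)]
      gcongr
    have hx1 : ‖z ^ 2 / ((4 * Λ : ℝ) : ℂ)‖ ≤ 1 :=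
      hx.trans ((div_le_one (by positivity)).mpr hsmall)
    unfold omega1
    exact (Complex.norm_exp_sub_one_le hx1).trans (by linarith)
  have hzinv : ‖Φ z‖ * ‖(Y : ℂ) ^ z‖ * ‖omega1 Λ z - 1‖ / ‖z‖ ≤
      M * Y ^ (‖c‖ + R) * (2 * ((‖c‖ + R) ^ 2 / (4 * Λ))) / (R - ‖c‖) := by
    have hnum : ‖Φ z‖ * ‖(Y : ℂ) ^ z‖ * ‖omega1 Λ z - 1‖ ≤
        M * Y ^ (‖c‖ + R) * (2 * ((‖c‖ + R) ^ 2 / (4 * Λ))) := by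
      have h1 : 0 ≤ Y ^ (‖c‖ + R) := by positivity
      have h2 : ‖Φ z‖ * ‖(Y : ℂ) ^ z‖ ≤ M * Y ^ (‖c‖ + R) :=
        mul_le_mul (hM z hz) hYz (norm_nonneg _) hM0
      exact mul_le_mul h2 hωz (norm_nonneg _) (mul_nonneg hM0 h1)
    have hnum0 : 0 ≤ M * Y ^ (‖c‖ + R) * (2 * ((‖c‖ + R) ^ 2 / (4 * Λ))) := by positivity
    calc _ ≤ M * Y ^ (‖c‖ + R) * (2 * ((‖c‖ + R) ^ 2 / (4 * Λ))) / ‖z‖ :=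
          div_le_div_of_nonneg_right hnum hzpos.le
      _ ≤ _ := div_le_div_of_nonneg_left hnum0 hRc hz2
  exact hzinv


/-! ### The remainder at Zhang's scales: `η = c₁/𝓛`, `H = 𝓛²⁰`, `Λ = 𝓛³⁰`, `T ≤ Y ≤ P` -/

open Skeleton in
/-- `⌈e^{M}⌉₊ ≤ D → M ≤ 𝓛 = log D`. [folklore] -/
private theorem le_ell_of_ceil_exp_le' {M : ℝ} {D : ℕ} (hD : ⌈Real.exp M⌉₊ ≤ D) : M ≤ ell D := by
  have h1 : Real.exp M ≤ D := le_trans (Nat.le_ceil _) (by exact_mod_cast hD)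
  have hD0 : (0 : ℝ) < D := lt_of_lt_of_le (Real.exp_pos M) h1
  rw [ell, Real.le_log_iff_exp_le hD0]
  exact h1

open Metric Skeleton in
/-- **The shifted big contour at the manuscript's scales** (the `O(ε₁)` form): for `0 < c₁ ≤ 1` there is
`D₀` such that for `D ≥ D₀`, with `η = c₁/𝓛`, `H = 𝓛²⁰`, `Λ = 𝓛³⁰` (`𝓛 = log D`) and `T ≤ Y ≤ P`, under
the hypotheses of `norm_vline_sub_circ_le`,
`‖(1/2π)∫_ℝ Φ(1+it)K_Y(1+it)dt − (2πi)⁻¹∮_{C(c,R)} Φ·K_Y‖ ≤ (M₀ + M₁ + M₂)·exp{−(c₁/2)𝓛^{1/10}}`,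
`M₀ = 27M_U`, `M₁ = M_UB_L²M_inv(1 + 4𝓛/c₁)`, `M₂ = 3M_UB_L²M_inv` — one call of the tree's
`GaussKernelContour.remainder_le_eps1` (`X = Y/T`, `k = 0`). In u025/u030 `c₁ = c/8` (`c` the zero-free
constant of `Lemma84.exceptional_package`), `M_U, B_L, M_inv = O(𝓛^{O(1)}·Π̂(dr)²)`, so the remainder is
`O(ε₁Π̂²)`, `ε₁ = exp{−c′𝓛^{1/10}}`. [cite: Zhang2022LandauSiegel, §12 proofs of Lemmas 12.2–12.3, pp. 69–70]
[cite: Zhang2022LandauSiegel, §7 p.41 (`ε₁`)] [cite: MontgomeryVaughan2007, §6.2] -/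
theorem norm_vline_sub_circ_le_eps1 {c₁ : ℝ} (hc₁ : 0 < c₁) (hc₁1 : c₁ ≤ 1) :
    ∃ D₀ : ℕ, ∀ ⦃D : ℕ⦄ [NeZero D], D₀ ≤ D →
      ∀ (χ : DirichletCharacter ℂ D) (U Φ : ℂ → ℂ) (s₀ βa βb : ℂ) ⦃ρ Y MU BL Minv : ℝ⦄ ⦃c : ℂ⦄ ⦃R : ℝ⦄,
      χ ≠ 1 → bigT D ≤ Y → Y ≤ bigP D → ‖s₀‖ ≤ c₁ / ell D / 10 →
      βa.re = 0 → ‖βa‖ ≤ 1 / 2 → βb.re = 0 → ‖βb‖ ≤ 1 / 2 →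
      DifferentiableOn ℂ U {s : ℂ | 9 / 10 < s.re} →
      (∀ s, Φ s = U (1 - s₀ + s) * χ.LFunction (1 - s₀ + s + βa) *
        χ.LFunction (1 - s₀ + s + βb) / χ.LFunction (1 - s₀ + s)) →
      0 ≤ MU → (∀ w : ℂ, 1 - 2 * (c₁ / ell D) ≤ w.re → ‖U w‖ ≤ MU) → 0 ≤ BL →
      (∀ w : ℂ, 1 - 2 * (c₁ / ell D) ≤ w.re → ‖w‖ ≤ ell D ^ 20 + 4 → ‖χ.LFunction w‖ ≤ BL) →
      0 ≤ Minv →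
      (∀ w : ℂ, 1 - 2 * (c₁ / ell D) ≤ w.re → |w.im| ≤ ell D ^ 20 + 1 → w ≠ (ρ : ℂ) →
        χ.LFunction w ≠ 0 ∧ ‖(χ.LFunction w)⁻¹‖ ≤ Minv * (1 + ‖w - ρ‖⁻¹)) →
      ρ < 1 → 1 - c₁ / ell D / 4 ≤ ρ → χ.LFunction ρ = 0 → deriv χ.LFunction ρ ≠ 0 →
      ((ρ - 1 : ℝ) : ℂ) + s₀ ≠ 0 → ‖c‖ + R ≤ c₁ / ell D →
      (0 : ℂ) ∈ ball c R → (((ρ - 1 : ℝ) : ℂ) + s₀) ∈ ball c R →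
      ‖(1 / (2 * π) : ℂ) * (∫ t : ℝ, Φ (((1 : ℝ) : ℂ) + t * I) *
            ((Y : ℂ) ^ (((1 : ℝ) : ℂ) + t * I + 0) * omega1 (ell D ^ 30) (((1 : ℝ) : ℂ) + t * I + 0) /
              (((1 : ℝ) : ℂ) + t * I + 0))) -
          (2 * π * I)⁻¹ * (∮ z in C(c, R), Φ z *
            ((Y : ℂ) ^ (z + 0) * omega1 (ell D ^ 30) (z + 0) / (z + 0)))‖ ≤
        (27 * MU + MU * BL * BL * (Minv * (1 + 4 / (c₁ / ell D))) + MU * BL * BL * (Minv * 3)) *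
          Real.exp (-(c₁ / 2) * ell D ^ (1 / 10 : ℝ)) := by
  obtain ⟨D₁, hD₁⟩ := remainder_le_eps1 hc₁ hc₁1 0
  refine ⟨max D₁ ⌈Real.exp 40⌉₊, ?_⟩
  intro D _ hD χ U Φ s₀ βa βb ρ Y MU BL Minv c R hχ1 hTY hYP hs₀ hβa hβa1 hβb hβb1 hUd hΦ hMU hU hBL
    hL hMinv hpack hρ1 hρη hLρ hL'ρ hsρ0 hcR h0 hρR
  have hD₁D : D₁ ≤ D := le_trans (le_max_left _ _) hD
  have hℓ40 : (40 : ℝ) ≤ ell D := le_ell_of_ceil_exp_le' (le_trans (le_max_right _ _) hD)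
  have hℓ0 : 0 < ell D := by linarith
  have hℓ1 : 1 ≤ ell D := by linarith
  set η : ℝ := c₁ / ell D with hηdef
  have hη : 0 < η := div_pos hc₁ hℓ0
  have hη40 : η ≤ 1 / 40 := by
    rw [hηdef, div_le_iff₀ hℓ0]
    nlinarith
  have hH : (2 : ℝ) ≤ ell D ^ 20 := by
    have : (1 : ℝ) ≤ ell D ^ 19 := one_le_pow₀ hℓ1
    nlinarith
  have hΛ : 0 < ell D ^ 30 := by positivity
  have hT1 : 1 ≤ bigT D := by
    rw [bigT]; exact Real.one_le_exp_iff.mpr (by positivity)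
  have hY1 : 1 ≤ Y := le_trans hT1 hTY
  have hY : 0 < Y := by linarith
  have ht0 : 1 ≤ t0 D := by rw [t0]; exact one_le_pow₀ hℓ1
  have hYPt : Y ≤ bigP D * t0 D := by
    have hP0 : 0 ≤ bigP D := (Real.exp_pos _).le
    nlinarith
  -- the contour bound with the explicit remainder
  have hmain := norm_vline_sub_circ_le χ U Φ s₀ βa βb (ρ := ρ) (η := η) (H := ell D ^ 20) (Y := Y)
    (MU := MU) (BL := BL) (Minv := Minv) hχ1 hΛ hY hη hη40 hH hs₀ hβa hβa1 hβb hβb1 hUd hΦ hMU hU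
    hBL hL hMinv hpack hρ1 hρη hLρ hL'ρ hsρ0 hcR h0 hρR
  refine hmain.trans ?_
  -- the scales
  set B : ℝ := 27 * MU + MU * BL * BL * (Minv * (1 + 4 / η)) + MU * BL * BL * (Minv * 3) with hBdef
  have hB0 : 0 ≤ 27 * MU := by positivity
  have hB1 : 0 ≤ MU * BL * BL * (Minv * (1 + 4 / η)) := by positivity
  have hB2 : 0 ≤ MU * BL * BL * (Minv * 3) := by positivity
  have hB : 0 ≤ B := by rw [hBdef]; positivity
  have hX : 0 < Y / bigT D := div_pos hY (by linarith)
  have hXT : Y / bigT D * bigT D ≤ Y := by rw [div_mul_cancel₀ _ (by linarith : bigT D ≠ 0)]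
  have hX1 : 1 ≤ Y / bigT D := by rw [le_div_iff₀ (by linarith)]; linarith
  have hM₀ : 27 * MU ≤ B * ell D ^ 0 := by rw [pow_zero, mul_one, hBdef]; linarith
  have hM₁ : MU * BL * BL * (Minv * (1 + 4 / η)) ≤ B * ell D ^ 0 * (Y / bigT D) ^ (c₁ / ell D) := by
    have h1 : (1 : ℝ) ≤ (Y / bigT D) ^ (c₁ / ell D) := Real.one_le_rpow hX1 (by positivity)
    rw [pow_zero, mul_one]
    calc MU * BL * BL * (Minv * (1 + 4 / η)) ≤ B := by rw [hBdef]; linarith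
      _ = B * 1 := (mul_one _).symm
      _ ≤ B * (Y / bigT D) ^ (c₁ / ell D) := by gcongr
  have hM₂ : MU * BL * BL * (Minv * 3) ≤ B * ell D ^ 0 * Y ^ (c₁ / ell D) := by
    have h1 : (1 : ℝ) ≤ Y ^ (c₁ / ell D) := Real.one_le_rpow hY1 (by positivity)
    rw [pow_zero, mul_one]
    calc MU * BL * BL * (Minv * 3) ≤ B := by rw [hBdef]; linarith
      _ = B * 1 := (mul_one _).symm
      _ ≤ B * Y ^ (c₁ / ell D) := by gcongr
  have h := hD₁ hD₁D (β := (0 : ℂ)) hB (by simp) (by simp) hY1 hYPt hX hXT le_rfl rfl rfl rfl hM₀ hM₁ hM₂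
  exact h


/-! ### Integrability on the line `Re s = 1` (for splitting `lineInt024` into two `Y`'s) -/

/-- **The line integrand is integrable**: with `‖U‖ ≤ M_U` on `Re w ≥ 3/2`, `‖s₀‖ ≤ η/10 ≤ 1/10`, `χ ≠ χ₀`,
`t ↦ Φ(1+it)·Y^{1+it}ω₁(1+it)/(1+it)` is integrable on `ℝ` (`Φ` is continuous and `≤ 27M_U` on the line,
the kernel is Gaussian-dominated: `GaussKernelContour.integrable_integrand_line`). Used to write u025's
`lineInt024` (kernel `(X₂^s − X₁^s)ω₁(s)/s`) as the difference of two single-`Y` line integrals.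
[cite: Zhang2022LandauSiegel, §12 proof of Lemma 12.2, p. 69] [cite: MontgomeryVaughan2007, §5.1] -/
theorem integrable_vline (hχ1 : χ ≠ 1) {Λ : ℝ} (hΛ : 0 < Λ) (hY : 0 < Y) (hη1 : η ≤ 1)
    (hs₀ : ‖s₀‖ ≤ η / 10) (hβa : βa.re = 0) (hβb : βb.re = 0)
    (hUd : DifferentiableOn ℂ U {s : ℂ | 9 / 10 < s.re})
    (hΦ : ∀ s, Φ s = U (1 - s₀ + s) * χ.LFunction (1 - s₀ + s + βa) *
      χ.LFunction (1 - s₀ + s + βb) / χ.LFunction (1 - s₀ + s))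
    (hMU : 0 ≤ MU) (hU : ∀ w : ℂ, 3 / 2 ≤ w.re → ‖U w‖ ≤ MU) :
    Integrable fun t : ℝ => Φ (((1 : ℝ) : ℂ) + t * I) *
      ((Y : ℂ) ^ (((1 : ℝ) : ℂ) + t * I + 0) * omega1 Λ (((1 : ℝ) : ℂ) + t * I + 0) /
        (((1 : ℝ) : ℂ) + t * I + 0)) := by
  obtain ⟨hre₀, -⟩ := abs_re_im_le s₀ hs₀
  have hre₀' := abs_le.mp hre₀
  have hΦ₀ : ∀ t : ℝ, ‖Φ (((1 : ℝ) : ℂ) + t * I)‖ ≤ 27 * MU := fun t =>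
    (norm_Phi_right_le' χ U Φ s₀ βa βb hs₀ hη1 hβa hβb hΦ hMU hU
      (s := ((1 : ℝ) : ℂ) + t * I) (by simp)).2
  have hcont : Continuous fun t : ℝ => Φ (((1 : ℝ) : ℂ) + t * I) := by
    have hline : Continuous fun t : ℝ => ((1 : ℝ) : ℂ) + t * I := by fun_prop
    refine continuous_iff_continuousAt.2 fun t => ?_
    have hd : DifferentiableAt ℂ Φ (((1 : ℝ) : ℂ) + t * I) := by
      refine differentiableAt_Phi χ U Φ s₀ βa βb hχ1 hUd hΦ ?_ ?_
      · rw [(u_re_im s₀ _).1]; simp; linarith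
      · exact (norm_Phi_right_le' χ U Φ s₀ βa βb hs₀ hη1 hβa hβb hΦ hMU hU
          (s := ((1 : ℝ) : ℂ) + t * I) (by simp)).1
    exact ContinuousAt.comp (g := Φ) (f := fun t : ℝ => ((1 : ℝ) : ℂ) + t * I) (x := t)
      hd.continuousAt hline.continuousAt
  exact integrable_integrand_line (Φ := Φ) (β := (0 : ℂ)) (Λ := Λ) hΛ hY (σ := (1 : ℝ))
    (M := 27 * MU) (by simp) hcont hΦ₀

end ShiftedContour

end Literature.NumberTheory.LFunctions.Zhang2022.Lemma84
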